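import Literature.Topology.PlaneTopology.JordanCurve
import Mathlib.Topology.Subpath
import Mathlib.Analysis.Convex.PathConnected
import Mathlib.Analysis.Normed.Affine.AddTorsor
import Mathlib.Analysis.Normed.Module.Convex
import Mathlib.Topology.Algebra.Order.Floor
import Mathlib.Analysis.Complex.Convex
import Mathlib.Analysis.Complex.UpperHalfPlane.Basic
import Mathlib.Analysis.SpecialFunctions.Complex.CircleMap
import HarnessLib


/-!
# Enclosure by a continuum in the closed half-plane (from the Jordan curve theorem)

Topic: Topology / plane topology. The main result of this file,
`Literature.Topology.PlaneTopology.JordanCurveTheorem.exists_isBounded_connectedComponentIn`, is the following consequence of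
the Jordan curve theorem (`Literature.Topology.PlaneTopology.JordanCurveTheorem` of
`Literature.Topology.PlaneTopology.JordanCurve`, McCleary (2006), Ch. 9, p. 129, kept as the
hypothesis `hJ`):

> Let `C ⊆ {im ≥ 0}` be compact and connected, containing two real points `a < b`, and let
> `x ∈ (a, b)` be a real point not on `C`. Then there is `r > 0` such that for every `z` with
> `|z - x| < r` and `im z > 0`, the connected component of `z` in `ℍₒ ∖ C` is bounded.

In words: a continuum of the closed upper half-plane joining two points of the real axis on
either side of `x` encloses, together with the real axis, a neighbourhood of `x` in the open upper
half-plane `ℍₒ`. This is the plane-topology input of "swallowing of real points by a Loewner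
chain generated by a curve = hitting of real rays by the curve" (`Literature.Probability.RandomPlanarGeometry.Loewner.hull` is the
complement of the unbounded component of `ℍₒ ∖ γ[0, t]`; see
`Literature.Probability.RandomPlanarGeometry.SLEBoundaryHitting`), applied to `C = γ[0, t]`.

## Proof

Suppose the component `V` of `z₀ = x + i y₀` (`y₀ = r/2`; all `z` near `x` in `ℍₒ` share it) in
`ℍₒ ∖ C` is unbounded. It is open and connected, so (`exists_path_injective`: in an open
connected plane set two points are joined by an *injective* path — the set of points reachable
by injective paths is open and closed, by chasing balls and cutting the path at its first
entrance into a small closed ball) there is an injective path `α ⊆ V` from `z₀` to a point of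
modulus `> R + 1`, where `C ⊆ B(0, R)`, `|x| + r < R`. Cut `α` at its first exit `t₁` from the
disc of radius `R + 1` and at its last visit `t₀ ≤ t₁` to the vertical segment `[x, x + i y₀]`,
and let `P` be the injective path `x → α(t₀)` (vertical) `→ α(t₁)` (along `α`) `→ R + 1` (along
the circle of radius `R + 1`, clockwise). Then `P` lies in `{im ≥ 0}`, is real exactly at its
endpoints `x`, `R + 1`, misses `C`, and near `x` it is the vertical line `re = x`. By the Jordan
curve theorem for the symmetric closed curve `J = P ∪ P̄` (`JordanCurveTheorem.symmetric`:
parametrise `P` followed by the reverse of `P̄` as a `1`-periodic loop injective on a period),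
`ℂ ∖ J = U ⊔ V'` with `U` bounded, `V'` unbounded and `J = ∂U = ∂V'`; the real ray `(-∞, x)`
lies in `V'`, and since near `x` the complement of `J` is two half-discs, one of which meets
`(-∞, x)`, the frontier property at `x` puts the other half-disc, hence the real interval
`(x, R + 1)`, inside `U` (`sides_of_symmetricJordan`). So `a ∈ V'` and `b ∈ U`; but `C ∪ C̄` is
connected, misses `J`, and contains both — contradiction.

## Contents

* injective paths: `injective_path_subpath`, `injective_path_trans(')`,
  `injOn_path_extend_trans_Ico(')` (a loop made of two arcs meeting at their endpoints is
  injective on `[0, 1)`), `injective_path_symm/map/cast`,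
  `path_continuous_extend_fract` (the `1`-periodic map of a closed path);
* `exists_path_injective` (simple arcs in open connected plane sets);
* circular arcs as paths: `range_segment_map_circleMap`, `injective_segment_map_circleMap`;
* first-entrance / last-visit parameters: `path_exists_first_mem`, `path_exists_last_mem`;
* `JordanCurveTheorem.symmetric`, `sides_of_symmetricJordan`,
  `JordanCurveTheorem.exists_isBounded_connectedComponentIn`.

## Mathlib

We USE `Path`, `Path.trans`, `Path.symm`, `Path.map`, `Path.cast`, `Path.extend`, `Path.subpath`
(`Mathlib.Topology.Subpath`), `Path.segment`, `Path.segment_injective_of_ne`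
(`Mathlib.Analysis.Convex.PathConnected`),
`ContinuousOn.comp_fract''` (periodic loops), `circleMap`, `eq_of_circleMap_eq`,
`Complex.norm_mul_exp_arg_mul_I`, `connectedComponentIn`, `IsPreconnected.subset_or_subset`,
`IsPreconnected.subset_left_of_subset_union`, `IsCompact.sInf_mem` / `sSup_mem`,
`convex_ball`, `convex_halfSpace_re_lt/gt`, `convex_halfSpace_im_gt`, `dist_lineMap_right`,
`Complex.dist_of_re_eq`. Mathlib has neither the Jordan curve theorem nor arcs in path-connected
sets (`rg "IsArc|exists_arc|Jordan curve" Mathlib` finds nothing relevant); the tree's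
`Literature.Topology.PlaneTopology.JordanCurveTheorem.of_periodic` (`JordanCurve.lean`) is the form of the theorem used.

## References

* J. McCleary, *A First Course in Topology: Continuity and Dimension*, AMS Student Math. Library
  31 (2006), Ch. 9, p. 129 (the Jordan curve theorem). [Mccleary2006]
* M. H. A. Newman, *Elements of the topology of plane sets of points*, Cambridge Univ. Press
  (1939), Ch. V (separation of the plane by closed curves; sides of a cross-cut). [Newman1939]
-/

noncomputable section

namespace Literature.Topology.PlaneTopology

open Set _root_.Topology Metric Filter Function
open scoped unitInterval

/-! ### Injective paths: sub-paths, concatenation, loops -/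

section PathLemmas

variable {X : Type*} [TopologicalSpace X] {a b c : X}

/-- A sub-path (between distinct parameters) of an injective path is injective. [folklore] -/
theorem injective_path_subpath {γ : Path a b} (hγ : Injective γ) {t₀ t₁ : I} (h : t₀ ≠ t₁) :
    Injective (γ.subpath t₀ t₁) := by
  intro s s' hs
  have h1 : Icc.convexComb t₀ t₁ s = Icc.convexComb t₀ t₁ s' := hγ hs
  have h2 := congrArg Subtype.val h1
  simp only [Icc.coe_convexComb] at h2
  have ht : (t₁ : ℝ) - t₀ ≠ 0 := fun e ↦ h (Subtype.ext (by linarith))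
  have h3 : ((s : ℝ) - s') * ((t₁ : ℝ) - t₀) = 0 := by linear_combination h2
  rcases mul_eq_zero.1 h3 with h4 | h4
  · exact Subtype.ext (by linarith)
  · exact absurd h4 ht

/-- The parameter of a sub-path: `γ.subpath t₀ t₁ s = γ u` with `u = (1 - s) t₀ + s t₁`. [folklore] -/
theorem path_subpath_apply (γ : Path a b) (t₀ t₁ s : I) :
    γ.subpath t₀ t₁ s = γ (Icc.convexComb t₀ t₁ s) := rfl

/-- Concatenation of two injective paths meeting only at the junction point is injective.
[folklore] -/
theorem injective_path_trans {γ₁ : Path a b} {γ₂ : Path b c} (h₁ : Injective γ₁) (h₂ : Injective γ₂)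
    (hr : ∀ s t, γ₁ s = γ₂ t → s = 1 ∧ t = 0) : Injective (γ₁.trans γ₂) := by
  intro x y hxy
  rw [Path.trans_apply, Path.trans_apply] at hxy
  split_ifs at hxy with hx hy hy
  · have := congrArg Subtype.val (h₁ hxy)
    simp only at this
    exact Subtype.ext (by linarith)
  · have := hr _ _ hxy
    have h3 := congrArg Subtype.val this.2
    simp only [Icc.coe_zero] at h3
    exact Subtype.ext (by
      have := congrArg Subtype.val this.1
      simp only [Icc.coe_one] at this
      linarith)
  · have := hr _ _ hxy.symm
    have h3 := congrArg Subtype.val this.2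
    simp only [Icc.coe_zero] at h3
    exact Subtype.ext (by
      have := congrArg Subtype.val this.1
      simp only [Icc.coe_one] at this
      linarith)
  · have := congrArg Subtype.val (h₂ hxy)
    simp only at this
    exact Subtype.ext (by linarith)

/-- A closed loop made of two injective paths `a → b → a` meeting only at `a` and `b` is
injective on `[0, 1)` (as a map on `ℝ` through `Path.extend`). [folklore] -/
theorem injOn_path_extend_trans_Ico {γ₁ : Path a b} {γ₂ : Path b a} (h₁ : Injective γ₁)
    (h₂ : Injective γ₂) (hr : ∀ s t, γ₁ s = γ₂ t → (s = 1 ∧ t = 0) ∨ (s = 0 ∧ t = 1)) :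
    InjOn (γ₁.trans γ₂).extend (Ico 0 1) := by
  intro x hx y hy hxy
  have hx' : x ∈ Icc (0 : ℝ) 1 := ⟨hx.1, hx.2.le⟩
  have hy' : y ∈ Icc (0 : ℝ) 1 := ⟨hy.1, hy.2.le⟩
  rw [Path.extend_apply _ hx', Path.extend_apply _ hy', Path.trans_apply, Path.trans_apply] at hxy
  simp only at hxy
  split_ifs at hxy with hxh hyh hyh
  · have := congrArg Subtype.val (h₁ hxy)
    simp only at this
    linarith
  · rcases hr _ _ hxy with ⟨hs, ht⟩ | ⟨hs, ht⟩
    · have hs' := congrArg Subtype.val hs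
      have ht' := congrArg Subtype.val ht
      simp only [Icc.coe_one, Icc.coe_zero] at hs' ht'
      linarith
    · have ht' := congrArg Subtype.val ht
      simp only [Icc.coe_one] at ht'
      linarith [hy.2]
  · rcases hr _ _ hxy.symm with ⟨hs, ht⟩ | ⟨hs, ht⟩
    · have hs' := congrArg Subtype.val hs
      have ht' := congrArg Subtype.val ht
      simp only [Icc.coe_one, Icc.coe_zero] at hs' ht'
      linarith
    · have ht' := congrArg Subtype.val ht
      simp only [Icc.coe_one] at ht'
      linarith [hx.2]
  · have := congrArg Subtype.val (h₂ hxy)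
    simp only at this
    linarith

/-- The `1`-periodic map `s ↦ γ (fract s)` traced by a closed path is continuous (the path
closes up). [folklore] -/
theorem path_continuous_extend_fract (γ : Path a a) : Continuous fun s : ℝ ↦ γ.extend (Int.fract s) :=
  ContinuousOn.comp_fract'' (γ.continuous_extend.continuousOn (s := I)) (by simp)

/-- `s ↦ γ (fract s)` is `1`-periodic. [folklore] -/
theorem path_periodic_extend_fract (γ : Path a a) : Periodic (fun s : ℝ ↦ γ.extend (Int.fract s)) 1 :=
  fun s ↦ by simp

/-- The range of `s ↦ γ (fract s)` is the range of `γ`. [folklore] -/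
theorem path_range_extend_fract (γ : Path a a) : range (fun s : ℝ ↦ γ.extend (Int.fract s)) = range γ := by
  apply Subset.antisymm
  · rintro _ ⟨s, rfl⟩
    rw [← γ.extend_range]
    exact mem_range_self _
  · rintro _ ⟨t, rfl⟩
    rcases eq_or_lt_of_le t.2.2 with h1 | h1
    · refine ⟨0, ?_⟩
      simp only [Int.fract_zero, Path.extend_zero]
      rw [show t = 1 from Subtype.ext h1, γ.target]
    · refine ⟨t, ?_⟩
      simp only [Int.fract_eq_self.2 (show (t : ℝ) ∈ Ico (0 : ℝ) 1 from ⟨t.2.1, h1⟩)]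
      rw [Path.extend_apply _ t.2]

end PathLemmas

/-! ### Simple arcs in plane domains -/

section Arcs

/-- Key step for `exists_path_injective`: if `q` is reachable from `p` by an injective path inside
`U` (or `q = p`) and `ball q r ⊆ U`, then every point of `ball q (r/2)` is reachable. [folklore] -/
theorem injectivePath_reachable_ball {U : Set ℂ} {p q : ℂ} (hq : q = p ∨ ∃ γ : Path p q, Injective γ ∧ range γ ⊆ U)
    {r : ℝ} (hball : ball q r ⊆ U) {q' : ℂ} (hq' : q' ∈ ball q (r / 2)) :
    q' = p ∨ ∃ γ : Path p q', Injective γ ∧ range γ ⊆ U := by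
  by_cases hpq' : q' = p
  · exact Or.inl hpq'
  right
  have hr0 : 0 < r := by linarith [pos_of_mem_ball hq']
  have hr2 : ball q (r / 2) ⊆ ball q r := ball_subset_ball (by linarith)
  rcases hq with rfl | ⟨γ, hγi, hγU⟩
  · -- straight segment from the centre
    refine ⟨Path.segment q q', Path.segment_injective_of_ne (Ne.symm hpq'), ?_⟩
    rw [Path.range_segment]
    exact ((convex_ball q r).segment_subset (mem_ball_self (lt_of_le_of_lt dist_nonneg
      (hr2 hq'))) (hr2 hq')).trans hball
  · by_cases hqq' : q' = q
    · subst hqq'; exact ⟨γ, hγi, hγU⟩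
    -- the closed ball around `q'` through `q`
    set ρ : ℝ := dist q q' with hρ
    have hρ0 : 0 < ρ := dist_pos.2 (Ne.symm hqq')
    have hBU : closedBall q' ρ ⊆ U := by
      refine Subset.trans (fun w hw ↦ ?_) hball
      rw [mem_closedBall] at hw
      rw [mem_ball]
      have := mem_ball.1 hq'
      calc dist w q ≤ dist w q' + dist q' q := dist_triangle _ _ _
        _ ≤ ρ + dist q' q := by linarith
        _ < r := by rw [hρ, dist_comm]; linarith
    -- first parameter at which `γ` enters the closed ball
    set S : Set ℝ := {t ∈ Icc (0 : ℝ) 1 | γ.extend t ∈ closedBall q' ρ} with hS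
    have hSc : IsClosed S :=
      isClosed_Icc.inter ((isClosed_closedBall).preimage γ.continuous_extend)
    have hScpt : IsCompact S := isCompact_Icc.of_isClosed_subset hSc (fun t ht ↦ ht.1)
    have h1S : (1 : ℝ) ∈ S := ⟨⟨zero_le_one, le_rfl⟩, by
      rw [Path.extend_one, mem_closedBall, hρ]⟩
    have hSne : S.Nonempty := ⟨1, h1S⟩
    set t₀ := sInf S with ht₀
    have ht₀S : t₀ ∈ S := hScpt.sInf_mem hSne
    have hbdd : BddBelow S := ⟨0, fun t ht ↦ ht.1.1⟩
    have hbefore : ∀ t ∈ Icc (0 : ℝ) 1, t < t₀ → γ.extend t ∉ closedBall q' ρ := fun t ht htt h ↦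
      absurd (csInf_le hbdd ⟨ht, h⟩) (not_le.2 htt)
    set w := γ.extend t₀ with hw
    have hwB : w ∈ closedBall q' ρ := ht₀S.2
    rcases eq_or_lt_of_le ht₀S.1.1 with h0 | h0
    · -- `t₀ = 0`: the segment from `p` does it
      have hpB : p ∈ closedBall q' ρ := by rw [← γ.extend_zero, h0]; exact hwB
      refine ⟨Path.segment p q', Path.segment_injective_of_ne (Ne.symm hpq'), ?_⟩
      rw [Path.range_segment]
      exact ((convex_closedBall q' ρ).segment_subset hpB (mem_closedBall_self hρ0.le)).trans hBU
    · -- `t₀ > 0`: follow `γ` up to `t₀`, then the segment to `q'`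
      set T₀ : I := ⟨t₀, ht₀S.1⟩ with hT₀
      have hT₀0 : (0 : I) ≠ T₀ := fun e ↦ by
        have := congrArg Subtype.val e
        simp only [Icc.coe_zero, hT₀] at this
        linarith
      have hγT₀ : γ T₀ = w := by rw [hw, Path.extend_apply _ ht₀S.1]
      have hdist : dist w q' = ρ := by
        apply le_antisymm (mem_closedBall.1 hwB)
        -- points before `t₀` are outside the closed ball; continuity
        have hcont : ContinuousWithinAt (fun t ↦ dist (γ.extend t) q') (Iio t₀) t₀ :=
          ((continuous_id.dist continuous_const).comp γ.continuous_extend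
            |>.continuousAt (x := t₀)).continuousWithinAt
        have hmem : ∀ᶠ t in 𝓝[<] t₀, ρ ≤ dist (γ.extend t) q' := by
          have : Ioo 0 t₀ ∈ 𝓝[<] t₀ := Ioo_mem_nhdsLT h0
          filter_upwards [this] with t ht
          have ht1 : t ∈ Icc (0 : ℝ) 1 := ⟨ht.1.le, (ht.2.le.trans ht₀S.1.2)⟩
          have := hbefore t ht1 ht.2
          rw [mem_closedBall, not_le] at this
          exact this.le
        haveI : (𝓝[<] t₀).NeBot := nhdsLT_neBot t₀
        exact ge_of_tendsto hcont.tendsto hmem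
      -- the sub-path and its intersection with the closed ball
      have hsub_range : ∀ s : I, γ.subpath 0 T₀ s ∈ closedBall q' ρ → s = 1 := by
        intro s hs
        rw [path_subpath_apply] at hs
        by_contra hs1
        have hlt : ((Icc.convexComb 0 T₀ s : I) : ℝ) < t₀ := by
          simp only [Icc.coe_convexComb, Icc.coe_zero, mul_zero, zero_add, hT₀]
          have hs' : (s : ℝ) < 1 := lt_of_le_of_ne s.2.2 (fun e ↦ hs1 (Subtype.ext e))
          nlinarith
        have := hbefore _ (Icc.convexComb 0 T₀ s).2 hlt
        rw [Path.extend_extends'] at this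
        exact this hs
      by_cases hwq : w = q'
      · refine ⟨(γ.subpath 0 T₀).cast γ.source.symm (by rw [hγT₀, hwq]), ?_, ?_⟩
        · simpa only [Path.cast_coe] using injective_path_subpath hγi hT₀0
        · intro z hz
          rw [Path.cast_coe, Path.range_subpath] at hz
          obtain ⟨u, -, rfl⟩ := hz
          exact hγU (mem_range_self u)
      · refine ⟨((γ.subpath 0 T₀).cast γ.source.symm hγT₀.symm).trans (Path.segment w q'), ?_, ?_⟩
        · apply injective_path_trans
          · simpa only [Path.cast_coe] using injective_path_subpath hγi hT₀0
          · exact Path.segment_injective_of_ne hwq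
          · intro s t hst
            simp only [Path.cast_coe, Path.segment_apply] at hst
            -- the common point lies in the closed ball, so `s = 1`; then it is `w`, so `t = 0`
            have hmem : γ.subpath 0 T₀ s ∈ closedBall q' ρ := by
              rw [hst, mem_closedBall, dist_lineMap_right, hdist, Real.norm_eq_abs,
                abs_of_nonneg (by linarith [t.2.2])]
              nlinarith [t.2.1, hρ0]
            have hs1 := hsub_range s hmem
            refine ⟨hs1, ?_⟩
            rw [hs1] at hst
            have h1 : γ.subpath 0 T₀ 1 = w := by rw [path_subpath_apply, Icc.convexComb_one, hγT₀]
            rw [h1] at hst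
            -- `w = lineMap w q' t` forces `t = 0`
            have h2 : dist (AffineMap.lineMap w q' (t : ℝ)) q' = ρ := by rw [← hst, hdist]
            rw [dist_lineMap_right, hdist, Real.norm_eq_abs, abs_of_nonneg (by linarith [t.2.2])]
              at h2
            have : (t : ℝ) = 0 := by nlinarith [hρ0]
            exact Subtype.ext this
        · rw [Path.trans_range]
          apply union_subset
          · intro z hz
            rw [Path.cast_coe, Path.range_subpath] at hz
            obtain ⟨u, -, rfl⟩ := hz
            exact hγU (mem_range_self u)
          · rw [Path.range_segment]
            exact ((convex_closedBall q' ρ).segment_subset hwB (mem_closedBall_self hρ0.le)).trans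
              hBU

/-- **Simple arcs in plane domains**: two distinct points of an open connected subset `U` of `ℂ`
are joined by an *injective* path inside `U` (the set of points reachable from `p` by injective
paths is open and closed in `U`, by `injectivePath_reachable_ball`). [folklore] -/
theorem exists_path_injective {U : Set ℂ} (hU : IsOpen U) (hUc : IsPreconnected U) {p q : ℂ}
    (hp : p ∈ U) (hq : q ∈ U) (hpq : p ≠ q) :
    ∃ γ : Path p q, Injective γ ∧ range γ ⊆ U := by
  set A : Set ℂ := {q ∈ U | q = p ∨ ∃ γ : Path p q, Injective γ ∧ range γ ⊆ U} with hA
  -- `A` is open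
  have hAo : IsOpen A := by
    rw [Metric.isOpen_iff]
    rintro q ⟨hqU, hq⟩
    obtain ⟨r, hr, hball⟩ := Metric.isOpen_iff.1 hU q hqU
    refine ⟨r / 2, by positivity, fun q' hq' ↦ ⟨?_, injectivePath_reachable_ball hq hball hq'⟩⟩
    exact hball (ball_subset_ball (by linarith) hq')
  -- `A` is closed in `U`
  have hAc : ∀ q ∈ U, q ∈ closure A → q ∈ A := by
    intro q hqU hqc
    obtain ⟨r, hr, hball⟩ := Metric.isOpen_iff.1 hU q hqU
    obtain ⟨q₁, hq₁A, hq₁⟩ := Metric.mem_closure_iff.1 hqc (r / 4) (by positivity)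
    have hball₁ : ball q₁ (r / 2) ⊆ U := by
      refine Subset.trans (fun z hz ↦ ?_) hball
      rw [mem_ball] at hz ⊢
      calc dist z q ≤ dist z q₁ + dist q₁ q := dist_triangle _ _ _
        _ < r / 2 + r / 4 := by rw [dist_comm q₁ q]; linarith
        _ < r := by linarith
    refine ⟨hqU, injectivePath_reachable_ball hq₁A.2 hball₁ ?_⟩
    rw [mem_ball]
    linarith
  -- connectedness
  have hpA : p ∈ A := ⟨hp, Or.inl rfl⟩
  have hUA : U ⊆ A := by
    refine hUc.subset_left_of_subset_union (v := (closure A)ᶜ) hAo isClosed_closure.isOpen_compl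
      ?_ ?_ ⟨p, hp, hpA⟩
    · exact disjoint_compl_right.mono_right (compl_subset_compl.2 subset_closure)
    · intro z hz
      by_cases h : z ∈ closure A
      · exact Or.inl (hAc z hz h)
      · exact Or.inr h
  rcases (hUA hq).2 with h | h
  · exact absurd h.symm hpq
  · exact h

end Arcs


/-! ### Circular arcs -/

section ArcPath

/-- `θ ↦ c + R e^{iθ}` is continuous (Mathlib's `continuous_circleMap` lives in the circle-integral
file; reproved here to keep imports light). [folklore] -/
theorem continuous_circleMap' (c : ℂ) (R : ℝ) : Continuous (circleMap c R) := by
  unfold circleMap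
  fun_prop

/-- `circleMap 0 ρ 0 = ρ`. [folklore] -/
theorem circleMap_zero_zero (ρ : ℝ) : circleMap 0 ρ 0 = ρ := by simp [circleMap]

/-- `circleMap 0 ‖z‖ (arg z) = z`. [folklore] -/
theorem circleMap_norm_arg (z : ℂ) : circleMap 0 ‖z‖ (Complex.arg z) = z := by
  rw [circleMap_zero]
  exact Complex.norm_mul_exp_arg_mul_I z

/-- The parameter of a segment path stays in the unordered interval. [folklore] -/
theorem lineMap_mem_uIcc (θ₀ θ₁ : ℝ) (s : I) : AffineMap.lineMap θ₀ θ₁ (s : ℝ) ∈ uIcc θ₀ θ₁ := by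
  rw [← segment_eq_uIcc, segment_eq_image_lineMap]
  exact ⟨s, s.2, rfl⟩

/-- The range of the circular arc `((Path.segment θ₀ θ₁).map _ : Path (circleMap 0 ρ θ₀) _)`.
[folklore] -/
theorem range_segment_map_circleMap (ρ θ₀ θ₁ : ℝ) :
    range ((Path.segment θ₀ θ₁).map (continuous_circleMap' 0 ρ)) = circleMap 0 ρ '' uIcc θ₀ θ₁ := by
  change range (circleMap 0 ρ ∘ Path.segment θ₀ θ₁) = _
  rw [range_comp, Path.range_segment, segment_eq_uIcc]

/-- A circular arc with angles in `[0, π]` between distinct angles is an injective path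
(`ρ ≠ 0`). [folklore] -/
theorem injective_segment_map_circleMap {ρ : ℝ} (hρ : ρ ≠ 0) {θ₀ θ₁ : ℝ} (h₀ : θ₀ ∈ Icc 0 Real.pi)
    (h₁ : θ₁ ∈ Icc 0 Real.pi) (hne : θ₀ ≠ θ₁) :
    Injective ((Path.segment θ₀ θ₁).map (continuous_circleMap' 0 ρ)) := by
  have hsub : uIcc θ₀ θ₁ ⊆ Icc 0 Real.pi := uIcc_subset_Icc h₀ h₁
  intro s t hst
  simp only [Path.map_coe, Function.comp_apply, Path.segment_apply] at hst
  have hs := hsub (lineMap_mem_uIcc θ₀ θ₁ s)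
  have ht := hsub (lineMap_mem_uIcc θ₀ θ₁ t)
  have h2 := eq_of_circleMap_eq hρ (by
    rw [abs_lt]; constructor <;> linarith [hs.1, hs.2, ht.1, ht.2, Real.pi_pos]) hst
  exact Path.segment_injective_of_ne hne (show Path.segment θ₀ θ₁ s = Path.segment θ₀ θ₁ t from h2)

end ArcPath

/-! ### First exit and last visit parameters of a path -/

section ExitTimes

variable {X : Type*} [TopologicalSpace X] {a b : X}

/-- **First entrance**: if the endpoint of a path lies in a closed set `F`, there is a first
parameter `t₁ ∈ [0, 1]` with `γ t₁ ∈ F`; before it the path avoids `F`. [folklore] -/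
theorem path_exists_first_mem (γ : Path a b) {F : Set X} (hF : IsClosed F) (hb : b ∈ F) :
    ∃ t₁ ∈ Icc (0 : ℝ) 1, γ.extend t₁ ∈ F ∧ ∀ t ∈ Icc (0 : ℝ) 1, t < t₁ → γ.extend t ∉ F := by
  set S : Set ℝ := {t ∈ Icc (0 : ℝ) 1 | γ.extend t ∈ F} with hS
  have hSc : IsClosed S := isClosed_Icc.inter (hF.preimage γ.continuous_extend)
  have hScpt : IsCompact S := isCompact_Icc.of_isClosed_subset hSc fun t ht ↦ ht.1
  have hSne : S.Nonempty := ⟨1, ⟨zero_le_one, le_rfl⟩, by rwa [Path.extend_one]⟩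
  have hmem : sInf S ∈ S := hScpt.sInf_mem hSne
  have hbdd : BddBelow S := ⟨0, fun t ht ↦ ht.1.1⟩
  exact ⟨sInf S, hmem.1, hmem.2, fun t ht htt h ↦ absurd (csInf_le hbdd ⟨ht, h⟩) (not_le.2 htt)⟩

/-- **Last visit before `t₁`**: if `γ 0 ∈ F` (`F` closed) and `t₁ ∈ [0, 1]`, there is a last
parameter `t₀ ∈ [0, t₁]` with `γ t₀ ∈ F`; on `(t₀, t₁]` the path avoids `F`. [folklore] -/
theorem path_exists_last_mem (γ : Path a b) {F : Set X} (hF : IsClosed F) (ha : a ∈ F) {t₁ : ℝ}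
    (ht₁ : t₁ ∈ Icc (0 : ℝ) 1) :
    ∃ t₀ ∈ Icc (0 : ℝ) t₁, γ.extend t₀ ∈ F ∧ ∀ t ∈ Icc (0 : ℝ) 1, t₀ < t → t ≤ t₁ → γ.extend t ∉ F := by
  set S : Set ℝ := {t ∈ Icc (0 : ℝ) t₁ | γ.extend t ∈ F} with hS
  have hSc : IsClosed S := isClosed_Icc.inter (hF.preimage γ.continuous_extend)
  have hScpt : IsCompact S := isCompact_Icc.of_isClosed_subset hSc fun t ht ↦ ht.1
  have hSne : S.Nonempty := ⟨0, ⟨le_rfl, ht₁.1⟩, by rwa [Path.extend_zero]⟩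
  have hmem : sSup S ∈ S := hScpt.sSup_mem hSne
  have hbdd : BddAbove S := ⟨t₁, fun t ht ↦ ht.1.2⟩
  exact ⟨sSup S, hmem.1, hmem.2, fun t ht htt htt₁ h ↦
    absurd (le_csSup hbdd ⟨⟨ht.1, htt₁⟩, h⟩) (not_le.2 htt)⟩

end ExitTimes


/-! ### More on injective paths -/

section PathLemmas2

variable {X Y : Type*} [TopologicalSpace X] [TopologicalSpace Y] {a b c : X}

/-- `injective_path_trans` with the junction condition stated on ranges. [folklore] -/
theorem injective_path_trans' {γ₁ : Path a b} {γ₂ : Path b c} (h₁ : Injective γ₁) (h₂ : Injective γ₂)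
    (hr : ∀ w ∈ range γ₁ ∩ range γ₂, w = b) : Injective (γ₁.trans γ₂) := by
  refine injective_path_trans h₁ h₂ fun s t hst ↦ ?_
  have hw : γ₁ s = b := hr _ ⟨mem_range_self s, hst ▸ mem_range_self t⟩
  constructor
  · apply h₁; rw [hw, γ₁.target]
  · apply h₂; rw [← hst, hw, γ₂.source]

/-- `injOn_path_extend_trans_Ico` with the junction condition stated on ranges. [folklore] -/
theorem injOn_path_extend_trans_Ico' {γ₁ : Path a b} {γ₂ : Path b a} (h₁ : Injective γ₁)
    (h₂ : Injective γ₂) (hr : ∀ w ∈ range γ₁ ∩ range γ₂, w = a ∨ w = b) :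
    InjOn (γ₁.trans γ₂).extend (Ico 0 1) := by
  refine injOn_path_extend_trans_Ico h₁ h₂ fun s t hst ↦ ?_
  rcases hr _ ⟨mem_range_self s, hst ▸ mem_range_self t⟩ with hw | hw
  · right
    constructor
    · apply h₁; rw [hw, γ₁.source]
    · apply h₂; rw [← hst, hw, γ₂.target]
  · left
    constructor
    · apply h₁; rw [hw, γ₁.target]
    · apply h₂; rw [← hst, hw, γ₂.source]

/-- The reverse of an injective path is injective. [folklore] -/
theorem injective_path_symm {γ : Path a b} (h : Injective γ) : Injective γ.symm := by
  intro s t hst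
  simp only [Path.symm_apply] at hst
  exact unitInterval.symm_bijective.injective (h hst)

/-- The image of an injective path under an injective continuous map is injective. [folklore] -/
theorem injective_path_map {γ : Path a b} (h : Injective γ) {f : X → Y} (hf : Continuous f)
    (hfi : Injective f) : Injective (γ.map hf) := by
  intro s t hst
  simp only [Path.map_coe, Function.comp_apply] at hst
  exact h (hfi hst)

/-- `Path.cast` does not change the underlying map, hence preserves injectivity. [folklore] -/
theorem injective_path_cast {γ : Path a b} (h : Injective γ) {a' b' : X} (ha : a' = a) (hb : b' = b) :
    Injective (γ.cast ha hb) := h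

end PathLemmas2

/-! ### A symmetric Jordan curve through two real points -/

section SymmetricJordan

open ComplexConjugate

/-- **Symmetric Jordan curves.** Let `P` be an injective path in the closed upper half-plane from
the real point `x` to the real point `y`, meeting the real axis only at its endpoints. From the
Jordan curve theorem (`Literature.Topology.PlaneTopology.JordanCurveTheorem`): the complement of `J = P ∪ P̄` (the path and its
mirror image) is the disjoint union of a bounded open connected set `U` and an unbounded open
connected set `V`, both with frontier `J`. [folklore] -/
theorem JordanCurveTheorem.symmetric (hJ : JordanCurveTheorem) {x y : ℝ}
    (P : Path (x : ℂ) (y : ℂ)) (hPi : Injective P) (him : ∀ s, 0 ≤ (P s).im)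
    (hreal : ∀ s, (P s).im = 0 → P s = x ∨ P s = y) :
    ∃ U V : Set ℂ, IsOpen U ∧ IsOpen V ∧ IsConnected U ∧ IsConnected V ∧ Disjoint U V ∧
      U ∪ V = (range P ∪ conj '' range P)ᶜ ∧ frontier U = range P ∪ conj '' range P ∧
      frontier V = range P ∪ conj '' range P ∧ Bornology.IsBounded U ∧ ¬ Bornology.IsBounded V := by
  -- the mirror path, reversed: from `y` back to `x`
  set Q : Path (y : ℂ) (x : ℂ) := ((P.map Complex.continuous_conj).symm).cast
    (Complex.conj_ofReal y).symm (Complex.conj_ofReal x).symm with hQ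
  have hQi : Injective Q :=
    injective_path_cast (injective_path_symm (injective_path_map hPi Complex.continuous_conj
      (starRingEnd ℂ).injective)) _ _
  have hQrange : range Q = conj '' range P := by
    rw [hQ, Path.cast_coe, Path.symm_range, Path.map_coe, range_comp]
  set L := P.trans Q with hL
  have hLrange : range (fun s : ℝ ↦ L.extend (Int.fract s)) = range P ∪ conj '' range P := by
    rw [path_range_extend_fract, hL, Path.trans_range, hQrange]
  have hinj : InjOn (fun s : ℝ ↦ L.extend (Int.fract s)) (Ico 0 1) := by
    intro s hs t ht hst
    simp only [Int.fract_eq_self.2 hs, Int.fract_eq_self.2 ht] at hst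
    refine injOn_path_extend_trans_Ico' hPi hQi (fun w ⟨hw₁, hw₂⟩ ↦ ?_) hs ht hst
    rw [hQrange] at hw₂
    obtain ⟨s₁, rfl⟩ := hw₁
    obtain ⟨w', ⟨s₂, rfl⟩, hw'⟩ := hw₂
    have h0 : (P s₁).im = 0 := by
      apply le_antisymm _ (him s₁)
      have := congrArg Complex.im hw'
      rw [Complex.conj_im] at this
      linarith [him s₂]
    exact hreal s₁ h0
  obtain ⟨U, V, hUo, hVo, hUc, hVc, hUV, hunion, hfU, hfV, hUb, hVb⟩ :=
    hJ.of_periodic (path_continuous_extend_fract L) (path_periodic_extend_fract L) hinj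
  rw [hLrange] at hunion hfU hfV
  exact ⟨U, V, hUo, hVo, hUc, hVc, hUV, hunion, hfU, hfV, hUb, hVb⟩

/-- **Sides of a symmetric Jordan curve.** In the situation of `JordanCurveTheorem.symmetric`, if
near `x` the curve `J` is the vertical line `re = x`, then the real ray `(-∞, x)` lies in the
unbounded component `V` and the real interval `(x, y)` in the bounded component `U`. [folklore] -/
theorem sides_of_symmetricJordan {x y : ℝ} (hxy : x < y) {J U V : Set ℂ} (hUo : IsOpen U) (hVo : IsOpen V)
    (hUV : Disjoint U V) (hunion : U ∪ V = Jᶜ) (hfU : frontier U = J)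
    (hUb : Bornology.IsBounded U) {ρ : ℝ} (hρ : 0 < ρ)
    (hloc : ∀ w ∈ ball (x : ℂ) ρ, w ∈ J ↔ w.re = x)
    (hJreal : ∀ w ∈ J, w.im = 0 → w = x ∨ w = y) :
    {w : ℂ | w.im = 0 ∧ w.re < x} ⊆ V ∧ {w : ℂ | w.im = 0 ∧ x < w.re ∧ w.re < y} ⊆ U := by
  have hJc : ∀ {s : Set ℂ}, (∀ w ∈ s, w ∉ J) → s ⊆ U ∪ V := fun h w hw ↦ by
    rw [hunion]; exact h w hw
  -- the left real ray lies in `V`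
  set ray : Set ℂ := {w : ℂ | w.im = 0 ∧ w.re < x} with hray
  have hray_eq : ray = Complex.ofReal '' Iio x := by
    ext w
    constructor
    · rintro ⟨h1, h2⟩
      exact ⟨w.re, h2, Complex.ext (by simp) (by simp [h1])⟩
    · rintro ⟨u, hu, rfl⟩
      exact ⟨Complex.ofReal_im u, by simpa using hu⟩
  have hray_conn : IsPreconnected ray := by
    rw [hray_eq]
    exact isPreconnected_Iio.image _ Complex.continuous_ofReal.continuousOn
  have hray_J : ∀ w ∈ ray, w ∉ J := by
    rintro w ⟨h1, h2⟩ hw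
    rcases hJreal w hw h1 with rfl | rfl
    · simp at h2
    · simp at h2; linarith
  have hrayV : ray ⊆ V := by
    rcases hray_conn.subset_or_subset hUo hVo hUV (hJc hray_J) with h | h
    · exfalso
      -- `U` is bounded but the ray is not
      obtain ⟨R, hR⟩ := hUb.subset_closedBall 0
      set w₀ : ℝ := -(|x| + |R| + 1) with hw₀
      have hmem : (w₀ : ℂ) ∈ ray := ⟨Complex.ofReal_im _, by
        simp only [Complex.ofReal_re, hw₀]
        linarith [abs_nonneg R, neg_abs_le x]⟩
      have h1 := Metric.mem_closedBall.1 (hR (h hmem))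
      rw [dist_zero_right, Complex.norm_real, Real.norm_eq_abs, hw₀, abs_neg,
        abs_of_pos (by positivity)] at h1
      linarith [le_abs_self R, abs_nonneg x]
    · exact h
  -- the two half-balls at `x`
  set HL : Set ℂ := ball (x : ℂ) ρ ∩ {w | w.re < x} with hHL
  set HR : Set ℂ := ball (x : ℂ) ρ ∩ {w | x < w.re} with hHR
  have hHL_J : ∀ w ∈ HL, w ∉ J := fun w hw hwJ ↦ by
    have := (hloc w hw.1).1 hwJ
    exact absurd this (ne_of_lt hw.2)
  have hHR_J : ∀ w ∈ HR, w ∉ J := fun w hw hwJ ↦ by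
    have := (hloc w hw.1).1 hwJ
    exact absurd this (ne_of_gt hw.2)
  have hHL_conn : IsPreconnected HL := ((convex_ball _ _).inter (convex_halfSpace_re_lt x)).isPreconnected
  have hHR_conn : IsPreconnected HR := ((convex_ball _ _).inter (convex_halfSpace_re_gt x)).isPreconnected
  have hxL : ((x - ρ / 2 : ℝ) : ℂ) ∈ HL := by
    refine ⟨?_, by simp [hρ]⟩
    rw [mem_ball, Complex.dist_eq, ← Complex.ofReal_sub, Complex.norm_real, Real.norm_eq_abs]
    rw [show x - ρ / 2 - x = -(ρ / 2) by ring, abs_neg, abs_of_pos (by positivity)]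
    linarith
  have hHLV : HL ⊆ V := by
    rcases hHL_conn.subset_or_subset hUo hVo hUV (hJc hHL_J) with h | h
    · exfalso
      have h1 : ((x - ρ / 2 : ℝ) : ℂ) ∈ V := hrayV ⟨Complex.ofReal_im _, by simp [hρ]⟩
      exact Set.disjoint_left.1 hUV (h hxL) h1
    · exact h
  -- `U` accumulates at `x ∈ J = frontier U`, hence contains the right half-ball
  have hxJ : (x : ℂ) ∈ J := (hloc x (mem_ball_self hρ)).2 (Complex.ofReal_re x)
  have hHRU : HR ⊆ U := by
    have hxcl : (x : ℂ) ∈ closure U := by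
      rw [← hfU] at hxJ
      exact frontier_subset_closure hxJ
    obtain ⟨w, hwU, hw⟩ := Metric.mem_closure_iff.1 hxcl ρ hρ
    have hwball : w ∈ ball (x : ℂ) ρ := by rwa [mem_ball, dist_comm]
    have hwJ : w ∉ J := by
      have : w ∈ U ∪ V := Or.inl hwU
      rw [hunion] at this
      exact this
    have hre : w.re ≠ x := fun h ↦ hwJ ((hloc w hwball).2 h)
    rcases lt_or_gt_of_ne hre with hlt | hgt
    · exact absurd (hHLV ⟨hwball, hlt⟩) (Set.disjoint_left.1 hUV hwU)
    · rcases hHR_conn.subset_or_subset hUo hVo hUV (hJc hHR_J) with h | h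
      · exact h
      · exact absurd (h ⟨hwball, hgt⟩) (Set.disjoint_left.1 hUV hwU)
  -- the real interval `(x, y)` lies in `U`
  refine ⟨hrayV, ?_⟩
  set seg : Set ℂ := {w : ℂ | w.im = 0 ∧ x < w.re ∧ w.re < y} with hseg
  have hseg_eq : seg = Complex.ofReal '' Ioo x y := by
    ext w
    constructor
    · rintro ⟨h1, h2, h3⟩
      exact ⟨w.re, ⟨h2, h3⟩, Complex.ext (by simp) (by simp [h1])⟩
    · rintro ⟨u, hu, rfl⟩
      exact ⟨Complex.ofReal_im u, by simpa using hu.1, by simpa using hu.2⟩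
  have hseg_conn : IsPreconnected seg := by
    rw [hseg_eq]
    exact isPreconnected_Ioo.image _ Complex.continuous_ofReal.continuousOn
  have hseg_J : ∀ w ∈ seg, w ∉ J := by
    rintro w ⟨h1, h2, h3⟩ hw
    rcases hJreal w hw h1 with rfl | rfl
    · simp at h2
    · simp at h3
  rcases hseg_conn.subset_or_subset hUo hVo hUV (hJc hseg_J) with h | h
  · exact h
  · exfalso
    -- a point of `seg` inside the right half-ball
    set δ : ℝ := min ρ (y - x) / 2 with hδ
    have hδ0 : 0 < δ := by
      have : 0 < min ρ (y - x) := lt_min hρ (by linarith)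
      positivity
    have hδρ : δ < ρ := by
      have := min_le_left ρ (y - x); rw [hδ]; linarith
    have hδy : x + δ < y := by
      have := min_le_right ρ (y - x); rw [hδ]; linarith
    have h1 : ((x + δ : ℝ) : ℂ) ∈ seg := ⟨Complex.ofReal_im _, by simp [hδ0], by simpa using hδy⟩
    have h2 : ((x + δ : ℝ) : ℂ) ∈ HR := by
      refine ⟨?_, by simp [hδ0]⟩
      rw [mem_ball, Complex.dist_eq, ← Complex.ofReal_sub, Complex.norm_real, Real.norm_eq_abs,
        show x + δ - x = δ by ring, abs_of_pos hδ0]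
      exact hδρ
    exact Set.disjoint_left.1 hUV (hHRU h2) (h h1)

end SymmetricJordan


/-! ### The enclosure lemma -/

section Enclosure

open ComplexConjugate
open UpperHalfPlane (upperHalfPlaneSet isOpen_upperHalfPlaneSet)

/-- **Enclosure lemma** (from the Jordan curve theorem). Let `C` be a compact connected subset of
the closed upper half-plane containing two real points `a < b`, and let `x ∈ (a, b)` be a real
point off `C`. Then the points of the open upper half-plane close to `x` lie in *bounded*
connected components of `ℍₒ ∖ C` ("`C` together with the real axis encloses a neighbourhood of `x`
in `ℍₒ`"). Proof: otherwise the component of `x + iy₀` is unbounded and open, so it contains an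
injective path from `x + iy₀` to a point of modulus `> R + 1` (`C ⊆ B(0, R)`,
`exists_path_injective`); after cutting it at its first exit from the disc of radius `R + 1` and at
its last visit to the vertical segment `[x, x + iy₀]`, and adding the vertical segment from `x`
and an arc of the circle of radius `R + 1` down to the real point `R + 1`, one gets an injective
path `P` from `x` to `R + 1` in the closed upper half-plane, off `C`, real only at its endpoints
and vertical near `x`; by `JordanCurveTheorem.symmetric` and `sides_of_symmetricJordan` the Jordan
curve `P ∪ P̄` separates `a` from `b`, contradicting the connectedness of `C ∪ C̄ ∌ P ∪ P̄`.
[folklore] -/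
theorem JordanCurveTheorem.exists_isBounded_connectedComponentIn (hJ : JordanCurveTheorem) {C : Set ℂ}
    (hCc : IsCompact C) (hCconn : IsPreconnected C) (hCim : ∀ w ∈ C, 0 ≤ w.im) {a x b : ℝ}
    (hax : a < x) (hxb : x < b) (ha : (a : ℂ) ∈ C) (hb : (b : ℂ) ∈ C) (hx : (x : ℂ) ∉ C) :
    ∃ r > 0, ∀ z ∈ ball (x : ℂ) r, 0 < z.im →
      Bornology.IsBounded (connectedComponentIn (upperHalfPlaneSet \ C) z) := by
  -- a closed ball around `x` free of `C`
  obtain ⟨r, hr, hrC⟩ : ∃ r > 0, closedBall (x : ℂ) r ⊆ Cᶜ := by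
    obtain ⟨ε, hε, hball⟩ := Metric.isOpen_iff.1 hCc.isClosed.isOpen_compl x hx
    exact ⟨ε / 2, by positivity, (closedBall_subset_ball (by linarith)).trans hball⟩
  refine ⟨r, hr, fun z hz hzim ↦ ?_⟩
  set U₀ : Set ℂ := upperHalfPlaneSet \ C with hU₀
  have hU₀o : IsOpen U₀ := isOpen_upperHalfPlaneSet.sdiff hCc.isClosed
  -- base point `z₀ = x + i y₀`, `y₀ = r / 2`, in the same component as `z`
  set y₀ : ℝ := r / 2 with hy₀
  have hy₀0 : 0 < y₀ := by positivity
  have hy₀r : y₀ < r := by rw [hy₀]; linarith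
  set z₀ : ℂ := ⟨x, y₀⟩ with hz₀
  have hH : ball (x : ℂ) r ∩ upperHalfPlaneSet ⊆ U₀ := fun w hw ↦
    ⟨hw.2, fun hC ↦ hrC (ball_subset_closedBall hw.1) hC⟩
  have hz₀ball : z₀ ∈ ball (x : ℂ) r := by
    rw [mem_ball, Complex.dist_of_re_eq (by simp [hz₀]), hz₀]
    simp [abs_of_pos hy₀0, hy₀r]
  have hz₀H : z₀ ∈ ball (x : ℂ) r ∩ upperHalfPlaneSet := ⟨hz₀ball, show 0 < z₀.im from hy₀0⟩
  have hconvH : Convex ℝ (ball (x : ℂ) r ∩ upperHalfPlaneSet) :=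
    (convex_ball _ _).inter (convex_halfSpace_im_gt 0)
  have hcc : connectedComponentIn U₀ z = connectedComponentIn U₀ z₀ :=
    connectedComponentIn_eq (hconvH.isPreconnected.subset_connectedComponentIn ⟨hz, hzim⟩ hH hz₀H)
  rw [hcc]
  set V := connectedComponentIn U₀ z₀ with hV
  by_contra hVb
  -- a large radius
  obtain ⟨R, hRx, hRC⟩ := hCc.isBounded.subset_ball_lt (|x| + r) 0
  have hR0 : 0 < R := lt_of_le_of_lt (by positivity) hRx
  -- a far point of `V`
  obtain ⟨q, hqV, hq⟩ : ∃ q ∈ V, R + 1 < ‖q‖ := by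
    by_contra hcon
    push Not at hcon
    exact hVb ((isBounded_closedBall (x := (0 : ℂ)) (r := R + 1)).subset fun w hw ↦ by
      simpa using hcon w hw)
  have hVo : IsOpen V := hU₀o.connectedComponentIn
  have hz₀V : z₀ ∈ V := mem_connectedComponentIn (hH hz₀H)
  have hVconn : IsPreconnected V := isPreconnected_connectedComponentIn
  have hVU₀ : V ⊆ U₀ := connectedComponentIn_subset _ _
  have hnz₀ : ‖z₀‖ < R + 1 := by
    have h1 : ‖z₀‖ ≤ ‖(x : ℂ)‖ + dist z₀ x := by
      have := norm_le_norm_add_norm_sub' z₀ (x : ℂ)  -- ‖z₀‖ ≤ ‖x‖ + ‖z₀ - x‖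
      rwa [← dist_eq_norm] at this
    rw [Complex.norm_real, Real.norm_eq_abs] at h1
    linarith [mem_ball.1 hz₀ball]
  have hz₀q : z₀ ≠ q := fun h ↦ by rw [h] at hnz₀; linarith
  obtain ⟨α, hαi, hαV⟩ := exists_path_injective hVo hVconn hz₀V hqV hz₀q
  have hαext : ∀ t, α.extend t ∈ V := fun t ↦ hαV (by
    rw [← α.extend_range]; exact mem_range_self t)
  -- first exit from the disc of radius `R + 1`
  obtain ⟨t₁, ht₁, ht₁F, hbefore⟩ :=
    path_exists_first_mem α (isClosed_le continuous_const continuous_norm) hq.le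
  have hbefore' : ∀ t ∈ Icc (0 : ℝ) 1, t < t₁ → ‖α.extend t‖ < R + 1 := fun t ht htt ↦
    not_le.1 fun h ↦ hbefore t ht htt h
  have ht₁F' : R + 1 ≤ ‖α.extend t₁‖ := ht₁F
  have ht₁0 : 0 < t₁ := by
    rcases eq_or_lt_of_le ht₁.1 with h | h
    · rw [← h, Path.extend_zero] at ht₁F'
      exact absurd ht₁F' (not_le.2 hnz₀)
    · exact h
  have hnorm₁ : ‖α.extend t₁‖ = R + 1 := by
    refine le_antisymm ?_ ht₁F'
    have hcont : ContinuousWithinAt (fun t ↦ ‖α.extend t‖) (Iio t₁) t₁ :=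
      ((continuous_norm.comp α.continuous_extend).continuousAt (x := t₁)).continuousWithinAt
    haveI : (𝓝[<] t₁).NeBot := nhdsLT_neBot t₁
    refine le_of_tendsto hcont.tendsto ?_
    filter_upwards [Ioo_mem_nhdsLT ht₁0] with t ht
    exact (hbefore' t ⟨ht.1.le, ht.2.le.trans ht₁.2⟩ ht.2).le
  -- last visit (before `t₁`) to the vertical segment `[x, x + i y₀]`
  set VS : Set ℂ := {w : ℂ | w.re = x ∧ w.im ∈ Icc 0 y₀} with hVS
  have hVSc : IsClosed VS :=
    (isClosed_eq Complex.continuous_re continuous_const).inter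
      (isClosed_Icc.preimage Complex.continuous_im)
  have hz₀VS : z₀ ∈ VS := ⟨rfl, hy₀0.le, le_rfl⟩
  obtain ⟨t₀, ht₀, ht₀F, hafter⟩ := path_exists_last_mem α hVSc hz₀VS ht₁
  set p₀ := α.extend t₀ with hp₀
  set h₀ : ℝ := p₀.im with hh₀
  have hp₀V : p₀ ∈ V := hαext t₀
  have hh₀0 : 0 < h₀ := (hVU₀ hp₀V).1
  have hp₀re : p₀.re = x := ht₀F.1
  have hh₀y : h₀ ≤ y₀ := ht₀F.2.2
  have hVSnorm : ∀ w ∈ VS, ‖w‖ < R + 1 := by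
    rintro w ⟨hw1, hw2, hw3⟩
    have h1 : ‖w‖ ≤ ‖(x : ℂ)‖ + dist w x := by
      have := norm_le_norm_add_norm_sub' w (x : ℂ)
      rwa [← dist_eq_norm] at this
    rw [Complex.norm_real, Real.norm_eq_abs, Complex.dist_of_re_eq (by simp [hw1]),
      Complex.ofReal_im, Real.dist_eq, sub_zero, abs_of_nonneg hw2] at h1
    linarith
  have ht₀1 : t₀ < t₁ := by
    rcases eq_or_lt_of_le ht₀.2 with h | h
    · exfalso
      have := hVSnorm p₀ ht₀F
      rw [hp₀, h, hnorm₁] at this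
      exact lt_irrefl _ this
    · exact h
  have ht₀I : t₀ ∈ Icc (0 : ℝ) 1 := ⟨ht₀.1, ht₀.2.trans ht₁.2⟩
  set T₀ : I := ⟨t₀, ht₀I⟩ with hT₀
  set T₁ : I := ⟨t₁, ht₁⟩ with hT₁
  have hT₀₁ : T₀ ≠ T₁ := fun h ↦ by
    have := congrArg Subtype.val h
    simp only [hT₀, hT₁] at this
    exact ht₀1.ne this
  have hT₀₁' : T₀ ≤ T₁ := Subtype.mk_le_mk.2 ht₀1.le
  set q₁ := α.extend t₁ with hq₁
  have hq₁V : q₁ ∈ V := hαext t₁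
  have hq₁im : 0 < q₁.im := (hVU₀ hq₁V).1
  have hαT₀ : α T₀ = p₀ := (α.extend_extends' T₀).symm
  have hαT₁ : α T₁ = q₁ := (α.extend_extends' T₁).symm
  -- the angle of `q₁`
  set θ₁ := Complex.arg q₁ with hθ₁
  have hθ₁0 : 0 < θ₁ := by
    refine lt_of_le_of_ne (Complex.arg_nonneg_iff.2 hq₁im.le) fun h ↦ ?_
    exact hq₁im.ne' (Complex.arg_eq_zero_iff.1 h.symm).2
  have hθ₁π : θ₁ < Real.pi := by
    refine lt_of_le_of_ne (Complex.arg_le_pi q₁) fun h ↦ ?_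
    exact hq₁im.ne' (Complex.arg_eq_pi_iff.1 h).2
  have hq₁pol : q₁ = circleMap 0 (R + 1) θ₁ := by rw [← hnorm₁, hθ₁, circleMap_norm_arg]
  -- the three pieces
  set P1 : Path (x : ℂ) p₀ := Path.segment (x : ℂ) p₀ with hP1
  set P2 : Path p₀ q₁ := (α.subpath T₀ T₁).cast hαT₀.symm hαT₁.symm with hP2
  set P3 : Path q₁ ((R + 1 : ℝ) : ℂ) :=
    ((Path.segment θ₁ 0).map (continuous_circleMap' 0 (R + 1))).cast hq₁pol
      (by rw [circleMap_zero_zero]) with hP3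
  -- points of the pieces
  have hP1pt : ∀ s : I, (P1 s).re = x ∧ (P1 s).im = (s : ℝ) * h₀ := by
    intro s
    rw [hP1, Path.segment_apply, AffineMap.lineMap_apply_module, Complex.real_smul,
      Complex.real_smul]
    refine ⟨?_, ?_⟩
    · rw [Complex.add_re, Complex.re_ofReal_mul, Complex.re_ofReal_mul, Complex.ofReal_re, hp₀re]
      ring
    · rw [Complex.add_im, Complex.im_ofReal_mul, Complex.im_ofReal_mul, Complex.ofReal_im, ← hh₀]
      ring
  have hR1 : ∀ w ∈ range P1, w.re = x ∧ 0 ≤ w.im ∧ w.im ≤ h₀ := by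
    rintro _ ⟨s, rfl⟩
    obtain ⟨h1, h2⟩ := hP1pt s
    refine ⟨h1, by rw [h2]; exact mul_nonneg s.2.1 hh₀0.le, by rw [h2]; nlinarith [s.2.2, hh₀0]⟩
  have hR2 : ∀ w ∈ range P2, w ∈ V ∧ ‖w‖ ≤ R + 1 ∧ (‖w‖ = R + 1 → w = q₁) ∧ (w ∈ VS → w = p₀) := by
    rintro _ ⟨s, rfl⟩
    rw [hP2, Path.cast_coe, path_subpath_apply]
    set u := Icc.convexComb T₀ T₁ s with hu
    have hu0 : T₀ ≤ u := Icc.le_convexComb hT₀₁' s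
    have hu1 : u ≤ T₁ := Icc.convexComb_le hT₀₁' s
    have hu0' : t₀ ≤ (u : ℝ) := hu0
    have hu1' : (u : ℝ) ≤ t₁ := hu1
    rw [← α.extend_extends' u]
    refine ⟨hαext u, ?_, fun hn ↦ ?_, fun hvs ↦ ?_⟩
    · rcases eq_or_lt_of_le hu1' with h | h
      · rw [h, hnorm₁]
      · exact (hbefore' u u.2 h).le
    · rcases eq_or_lt_of_le hu1' with h | h
      · rw [h]
      · exact absurd hn (hbefore' u u.2 h).ne
    · rcases eq_or_lt_of_le hu0' with h | h
      · rw [← h]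
      · exact absurd hvs (hafter u u.2 h hu1')
  have hR3 : ∀ w ∈ range P3, ‖w‖ = R + 1 ∧ 0 ≤ w.im ∧ (w.im = 0 → w = ((R + 1 : ℝ) : ℂ)) := by
    intro w hw
    rw [hP3, Path.cast_coe, range_segment_map_circleMap, uIcc_of_ge hθ₁0.le] at hw
    obtain ⟨θ, hθ, rfl⟩ := hw
    refine ⟨by rw [norm_circleMap_zero, abs_of_pos (by linarith)], ?_, fun h0 ↦ ?_⟩
    · rw [circleMap_zero_im]
      exact mul_nonneg (by linarith) (Real.sin_nonneg_of_nonneg_of_le_pi hθ.1 (hθ.2.trans hθ₁π.le))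
    · rw [circleMap_zero_im] at h0
      rcases mul_eq_zero.1 h0 with h | h
      · linarith
      · rw [(Real.sin_eq_zero_iff_of_lt_of_lt (by linarith [Real.pi_pos, hθ.1])
          (hθ.2.trans_lt hθ₁π)).1 h, circleMap_zero_zero]
  -- injectivity of the pieces and of their concatenation
  have hxp₀ : (x : ℂ) ≠ p₀ := fun h ↦ by
    have := congrArg Complex.im h
    rw [Complex.ofReal_im] at this
    exact hh₀0.ne this
  have hP1i : Injective P1 := Path.segment_injective_of_ne hxp₀
  have hP2i : Injective P2 := injective_path_cast (injective_path_subpath hαi hT₀₁) _ _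
  have hP3i : Injective P3 := injective_path_cast (injective_segment_map_circleMap (by linarith)
    ⟨hθ₁0.le, hθ₁π.le⟩ ⟨le_rfl, Real.pi_pos.le⟩ hθ₁0.ne') _ _
  have hP23i : Injective (P2.trans P3) :=
    injective_path_trans' hP2i hP3i fun w ⟨hw2, hw3⟩ ↦ (hR2 w hw2).2.2.1 (hR3 w hw3).1
  set P := P1.trans (P2.trans P3) with hP
  have hPi : Injective P := by
    refine injective_path_trans' hP1i hP23i fun w ⟨hw1, hw23⟩ ↦ ?_
    rw [Path.trans_range] at hw23
    obtain ⟨h1, h2, h3⟩ := hR1 w hw1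
    rcases hw23 with hw2 | hw3
    · exact (hR2 w hw2).2.2.2 ⟨h1, h2, h3.trans hh₀y⟩
    · exfalso
      have := hVSnorm w ⟨h1, h2, h3.trans hh₀y⟩
      rw [(hR3 w hw3).1] at this
      exact lt_irrefl _ this
  have hPrange : range P = range P1 ∪ (range P2 ∪ range P3) := by
    rw [hP, Path.trans_range, Path.trans_range]
  -- points of `P`: in the closed upper half-plane, real only at the endpoints, off `C`
  have him : ∀ w ∈ range P, 0 ≤ w.im := by
    intro w hw
    rw [hPrange] at hw
    rcases hw with hw | hw | hw
    · exact (hR1 w hw).2.1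
    · exact ((hVU₀ (hR2 w hw).1).1 : 0 < w.im).le
    · exact (hR3 w hw).2.1
  have hreal : ∀ w ∈ range P, w.im = 0 → w = x ∨ w = ((R + 1 : ℝ) : ℂ) := by
    intro w hw h0
    rw [hPrange] at hw
    rcases hw with hw | hw | hw
    · left
      obtain ⟨s, rfl⟩ := hw
      obtain ⟨h1, h2⟩ := hP1pt s
      rw [h0] at h2
      have hs : (s : ℝ) = 0 := by
        rcases mul_eq_zero.1 h2.symm with h | h
        · exact h
        · exact absurd h hh₀0.ne'
      rw [show s = 0 from Subtype.ext hs, P1.source]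
    · exact absurd h0 ((hVU₀ (hR2 w hw).1).1 : 0 < w.im).ne'
    · exact Or.inr ((hR3 w hw).2.2 h0)
  have hPC : ∀ w ∈ range P, w ∉ C := by
    intro w hw hwC
    rw [hPrange] at hw
    rcases hw with hw | hw | hw
    · obtain ⟨h1, h2, h3⟩ := hR1 w hw
      refine hrC ?_ hwC
      rw [mem_closedBall, Complex.dist_of_re_eq (by simp [h1]), Complex.ofReal_im, Real.dist_eq,
        sub_zero, abs_of_nonneg h2]
      linarith
    · exact (hVU₀ (hR2 w hw).1).2 hwC
    · have h1 := hRC hwC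
      rw [mem_ball, dist_zero_right, (hR3 w hw).1] at h1
      linarith
  -- the Jordan curve `J = P ∪ conj P`
  have hxR : x < R + 1 := by linarith [le_abs_self x]
  obtain ⟨Ui, Vo, hUio, hVoo, hUic, hVoc, hUV, hunion, hfU, hfV, hUib, hVob⟩ :=
    hJ.symmetric P hPi (fun s ↦ him _ (mem_range_self s)) (fun s ↦ hreal _ (mem_range_self s))
  set J := range P ∪ conj '' range P with hJdef
  -- near `x`, `J` is the vertical line
  obtain ⟨δ₂, hδ₂, hδ₂P⟩ : ∃ δ > 0, ball (x : ℂ) δ ⊆ (range P2)ᶜ := by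
    have hxP2 : (x : ℂ) ∈ (range P2)ᶜ := fun h ↦ by
      have := (hVU₀ (hR2 _ h).1).1
      simp at this
    exact Metric.isOpen_iff.1 (isCompact_range P2.continuous).isClosed.isOpen_compl _ hxP2
  set ρ := min h₀ δ₂ with hρ
  have hρ0 : 0 < ρ := lt_min hh₀0 hδ₂
  have hρh : ρ ≤ h₀ := min_le_left _ _
  have hρδ : ρ ≤ δ₂ := min_le_right _ _
  have hlocP : ∀ w ∈ range P, dist w x < ρ → w.re = x := by
    intro w hw hd
    rw [hPrange] at hw
    rcases hw with hw | hw | hw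
    · exact (hR1 w hw).1
    · exact absurd hw (hδ₂P (mem_ball.2 (hd.trans_le hρδ)))
    · exfalso
      have h1 : ‖w‖ ≤ ‖(x : ℂ)‖ + dist w x := by
        have := norm_le_norm_add_norm_sub' w (x : ℂ)
        rwa [← dist_eq_norm] at this
      rw [Complex.norm_real, Real.norm_eq_abs, (hR3 w hw).1] at h1
      linarith
  have hvert : ∀ w : ℂ, w.re = x → 0 ≤ w.im → w.im < h₀ → w ∈ range P := by
    intro w h1 h2 h3
    rw [hPrange]
    left
    have hs : w.im / h₀ ∈ I := ⟨div_nonneg h2 hh₀0.le, (div_le_one hh₀0).2 h3.le⟩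
    refine ⟨⟨w.im / h₀, hs⟩, ?_⟩
    obtain ⟨h4, h5⟩ := hP1pt ⟨w.im / h₀, hs⟩
    apply Complex.ext
    · rw [h4, h1]
    · rw [h5]
      simp only
      field_simp
  have hloc : ∀ w ∈ ball (x : ℂ) ρ, w ∈ J ↔ w.re = x := by
    intro w hw
    rw [mem_ball] at hw
    constructor
    · rintro (hwP | ⟨w', hw'P, rfl⟩)
      · exact hlocP w hwP hw
      · have : dist w' x < ρ := by
          rwa [Complex.dist_eq, ← Complex.conj_ofReal, ← map_sub, Complex.norm_conj,
            ← Complex.dist_eq] at hw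
        have := hlocP w' hw'P this
        rwa [Complex.conj_re]
    · intro hre
      have him' : |w.im| < ρ := by
        rwa [Complex.dist_of_re_eq (by simp [hre]), Complex.ofReal_im, Real.dist_eq, sub_zero] at hw
      rcases le_or_gt 0 w.im with h | h
      · left
        exact hvert w hre h (by linarith [le_abs_self w.im])
      · right
        refine ⟨conj w, hvert (conj w) (by simpa using hre) ?_ ?_, Complex.conj_conj w⟩
        · simp; linarith
        · simp; linarith [neg_abs_le w.im]
  have hJreal : ∀ w ∈ J, w.im = 0 → w = x ∨ w = ((R + 1 : ℝ) : ℂ) := by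
    rintro w (hwP | ⟨w', hw'P, rfl⟩) h0
    · exact hreal w hwP h0
    · rw [Complex.conj_im, neg_eq_zero] at h0
      have hw' : conj w' = w' := Complex.conj_eq_iff_im.2 h0
      rw [hw']
      exact hreal w' hw'P h0
  obtain ⟨hrayV, hsegU⟩ := sides_of_symmetricJordan hxR hUio hVoo hUV hunion hfU hUib hρ0 hloc hJreal
  -- `a` is outside, `b` is inside
  have haV : (a : ℂ) ∈ Vo := hrayV ⟨Complex.ofReal_im a, by simpa using hax⟩
  have hbU : (b : ℂ) ∈ Ui := by
    refine hsegU ⟨Complex.ofReal_im b, by simpa using hxb, ?_⟩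
    have h1 := hRC hb
    rw [mem_ball, dist_zero_right, Complex.norm_real, Real.norm_eq_abs] at h1
    simp only [Complex.ofReal_re]
    linarith [le_abs_self b]
  -- `C ∪ conj C` is connected and misses `J`
  have hCJ : ∀ w ∈ C, w ∉ J := by
    rintro w hwC (hwP | ⟨w', hw'P, hw'⟩)
    · exact hPC w hwP hwC
    · have h1 : w'.im = 0 := by
        apply le_antisymm _ (him w' hw'P)
        have := hCim w hwC
        rw [← hw', Complex.conj_im] at this
        linarith
      have : w = w' := by rw [← hw', Complex.conj_eq_iff_im.2 h1]
      exact hPC w' hw'P (this ▸ hwC)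
  have hCJ' : ∀ w ∈ conj '' C, w ∉ J := by
    rintro _ ⟨c, hcC, rfl⟩ (hwP | ⟨w', hw'P, hw'⟩)
    · have h1 : c.im = 0 := by
        apply le_antisymm _ (hCim c hcC)
        have := him _ hwP
        rw [Complex.conj_im] at this
        linarith
      rw [Complex.conj_eq_iff_im.2 h1] at hwP
      exact hPC c hwP hcC
    · have : w' = c := (starRingEnd ℂ).injective hw'
      exact hPC c (this ▸ hw'P) hcC
  have hCstar : IsPreconnected (C ∪ conj '' C) :=
    IsPreconnected.union (a : ℂ) ha ⟨a, ha, Complex.conj_ofReal a⟩ hCconn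
      (hCconn.image _ Complex.continuous_conj.continuousOn)
  have hsub : C ∪ conj '' C ⊆ Ui ∪ Vo := by
    rw [hunion]
    rintro w (hw | hw)
    · exact hCJ w hw
    · exact hCJ' w hw
  have haC : (a : ℂ) ∈ C ∪ conj '' C := Or.inl ha
  have hbC : (b : ℂ) ∈ C ∪ conj '' C := Or.inl hb
  rcases hCstar.subset_or_subset hUio hVoo hUV hsub with h | h
  · exact Set.disjoint_left.1 hUV (h haC) haV
  · exact Set.disjoint_left.1 hUV hbU (h hbC)

end Enclosure

end Literature.Topology.PlaneTopology
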